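import Summits.ValiantsHypothesis.ValiantsHypothesis.Theorems.FifoMatchingNNDivisionHardLocalizationPatternSplit

/-!
# FifoMatching · NNDivisionHard · Localization — `PatternSplit` PART B: the defective genus `UPatAtD` / `UPatDF` (decided) and
smooth-passenger immunity (`UniqueNormal`, `euclidBall`)

Theorems port (val-idea-41 g6 staging; declarations verbatim, namespace moved) of `Cruxes/NNDivisionHard/PatternSplit41.lean` rev 1
@db0e975a6158 (sha16 a8d5d1a0460253ce), §3b–§4; PART A (`…LocalizationPatternSplit`) holds §1–§3 and the full section guide.
Honest label as in PART A: structure theorem + a decided widening + one immunity theorem; 21181 OPEN; VP ≠ VNP NOT proved.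
-/

set_option linter.dupNamespace false

namespace Summit.ValiantsHypothesis.ValiantsHypothesis.Theorems.FifoMatching.PatternSplit

open Matrix Finset
open scoped Pointwise
open Literature.Barriers.PneNP (HasEFOfSize disjPairs mem_disjPairs card_disjPairs IsKWValid)
open Literature.Combinatorics.Optimization (corPolytopeGraph corVec)
open Summit.ValiantsHypothesis.ValiantsHypothesis.Theorems.FifoMatching.Localization (Fam UPatAt)

section Currency

variable {h K m : ℕ}

/-! ### §3b Genus I WITH DEFECTS: `UPatAtD` — up to a third of the disjoint cells may fail to be strict -/

open Classical in
/-- **`UPatAtD q m D`**: as `UPatAt q m` but at most `D` DISJOINT cells are allowed to be non-strict (slack `0` instead of `> 0`).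
Sub-boards do not remove defects (the `m²` cells `({i},{j})` meet every sub-board of order `≥ 2`), so this is a genuinely wider pattern
notion; it is decided by the defect-tolerant bound all the same. -/
def UPatAtD (q : Fam h K) (m D : ℕ) : Prop :=
  ∃ (c : Finset (Fin m) → (Fin h × Fin h → ℝ)) (d : Finset (Fin m) → ℝ) (x : Finset (Fin m) → (Fin h × Fin h → ℝ)),
    (∀ a, ∀ w ∈ corPolytopeGraph (⊤ : SimpleGraph (Fin h)) + convexHull ℝ (Set.range q), c a ⬝ᵥ w ≤ d a) ∧
    (∀ b, x b ∈ corPolytopeGraph (⊤ : SimpleGraph (Fin h)) + convexHull ℝ (Set.range q)) ∧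
    (∀ a b, (a ∩ b).card = 1 → c a ⬝ᵥ x b = d a) ∧
    ((disjPairs (univ : Finset (Fin m))).filter fun p => c p.1 ⬝ᵥ x p.2 = d p.1).card ≤ D

open Classical in
/-- zero defects is the genus-I pattern. -/
theorem uPatAtD_zero_iff {q : Fam h K} : UPatAtD q m 0 ↔ UPatAt q m := by
  constructor
  · rintro ⟨c, d, x, hval, hx, ht, hcard⟩
    refine ⟨c, d, x, hval, hx, ht, fun a b hab => lt_of_le_of_ne (hval a (x b) (hx b)) fun heq => ?_⟩
    rw [Nat.le_zero, card_eq_zero] at hcard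
    have hmem : (a, b) ∈ (disjPairs (univ : Finset (Fin m))).filter fun p => c p.1 ⬝ᵥ x p.2 = d p.1 :=
      mem_filter.2 ⟨mem_disjPairs.2 ⟨subset_univ _, subset_univ _, hab⟩, heq⟩
    rw [hcard] at hmem
    exact notMem_empty _ hmem
  · rintro ⟨c, d, x, hval, hx, ht, hdisj⟩
    refine ⟨c, d, x, hval, hx, ht, le_of_eq (card_eq_zero.2 (filter_eq_empty_iff.2 fun p hp heq => ?_))⟩
    exact absurd heq (ne_of_lt (hdisj p.1 p.2 (mem_disjPairs.1 hp).2.2))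

open Classical in
/-- ★ **the defective pattern bound** (budget-free): `3^m ≤ (r+1)·2^m + D`. -/
theorem uPatAtD_three_pow_le {q : Fam h K} {D : ℕ} (hq : UPatAtD q m D) {r : ℕ}
    (hEF : HasEFOfSize (corPolytopeGraph (⊤ : SimpleGraph (Fin h)) + convexHull ℝ (Set.range q)) r) :
    3 ^ m ≤ (r + 1) * 2 ^ m + D := by
  obtain ⟨c, d, x, hval, hx, ht, hcard⟩ := hq
  have := three_pow_le_add_card_defects hEF x hx c d hval ht
  omega

/-- with at most a third of the `3^m` disjoint cells defective, the order-`(m−1)` Kaibel–Weltge inequality survives. -/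
theorem uPatAtD_three_pow_pred_le {q : Fam h K} {D : ℕ} (hq : UPatAtD q m D) (hD : 3 * D ≤ 3 ^ m) (hm : 1 ≤ m) {r : ℕ}
    (hEF : HasEFOfSize (corPolytopeGraph (⊤ : SimpleGraph (Fin h)) + convexHull ℝ (Set.range q)) r) :
    3 ^ (m - 1) ≤ (r + 1) * 2 ^ (m - 1) := by
  have h := uPatAtD_three_pow_le hq hEF
  obtain ⟨k, rfl⟩ : ∃ k, m = k + 1 := ⟨m - 1, by omega⟩
  rw [Nat.add_sub_cancel]
  rw [pow_succ, pow_succ] at h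
  rw [pow_succ] at hD
  set X := 3 ^ k
  set Y := 2 ^ k
  nlinarith

/-- **`UPatDF s`**: a defective unique-disjointness pattern of order `> s h` with at most a third of its disjoint cells defective. -/
def UPatDF (s : ℕ → ℕ) : Summit.ValiantsHypothesis.ValiantsHypothesis.Theorems.FifoMatching.Localization.PClass :=
  fun h _ q => ∃ m, s h + 1 ≤ m ∧ ∃ D, 3 * D ≤ 3 ^ m ∧ UPatAtD q m D

/-- genus I sits inside the defective genus (one order higher, zero defects). -/
theorem uPatF_succ_le_uPatDF {s : ℕ → ℕ} {q : Fam h K}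
    (hq : Summit.ValiantsHypothesis.ValiantsHypothesis.Theorems.FifoMatching.Localization.UPatF (fun h => s h + 1) h K q) :
    UPatDF s h K q := by
  obtain ⟨m, hm, hP⟩ := hq
  exact ⟨m, hm, 0, Nat.zero_le _, uPatAtD_zero_iff.2 hP⟩

/-- ★ **the defective genus is DECIDED** (same floors and exchanges as `decided_uPatF`). -/
theorem decided_uPatDF {s : ℕ → ℕ} (hgrow : ∀ h₀ : ℕ, ∃ h₁ : ℕ, ∀ h ≥ h₁, h₀ ≤ s h)
    (hex : ∀ c : ℕ, ∃ c' h₁ : ℕ, ∀ h ≥ h₁, ∀ ℓ, s h ≤ ℓ →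
      Summit.ValiantsHypothesis.ValiantsHypothesis.Theorems.FifoMatching.Localization.T c h ≤
        Summit.ValiantsHypothesis.ValiantsHypothesis.Theorems.FifoMatching.Localization.T c' ℓ) :
    Summit.ValiantsHypothesis.ValiantsHypothesis.Theorems.FifoMatching.Localization.Decided (UPatDF s) := by
  intro c
  obtain ⟨c', h₁, hh₁⟩ := hex c
  obtain ⟨m₀, hm₀⟩ := Summit.ValiantsHypothesis.ValiantsHypothesis.Theorems.FifoMatching.Localization.T_lt_of_three_pow c'
  obtain ⟨h₂, hh₂⟩ := hgrow m₀
  refine ⟨h₁ + h₂, fun h hh K q r hq hEF => ?_⟩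
  obtain ⟨m, hm, D, hD, hP⟩ := hq
  have hs : s h ≤ m - 1 := by omega
  exact lt_of_le_of_lt (hh₁ h (by omega) (m - 1) hs)
    (hm₀ (m - 1) ((hh₂ h (by omega)).trans hs) r (uPatAtD_three_pow_pred_le hP hD (by omega) hEF))

/-- `UPatD := UPatDF ⌊√·⌋` is decided (floor `⌊√h⌋`, exchange `c ↦ 2c`). -/
theorem uPatD_decided : Summit.ValiantsHypothesis.ValiantsHypothesis.Theorems.FifoMatching.Localization.Decided (UPatDF Nat.sqrt) := by
  refine decided_uPatDF ?_ ?_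
  · intro h₀
    refine ⟨h₀ * h₀, fun h hh => ?_⟩
    calc h₀ = Nat.sqrt (h₀ * h₀) := (Nat.sqrt_eq h₀).symm
      _ ≤ Nat.sqrt h := Nat.sqrt_le_sqrt hh
  · intro c
    exact ⟨2 * c, 0, fun h _ ℓ hℓ => Summit.ValiantsHypothesis.ValiantsHypothesis.Theorems.FifoMatching.Localization.T_le_T_double c hℓ⟩

end Currency

/-! ## §4 The limit remark: a smooth passenger is totally immune -/

section Smooth

variable {ι : Type} [Fintype ι]

/-- `UniqueNormal Q`: every point of `Q` that maximises a NONZERO functional `c₁` over `Q` maximises only the positive multiples of `c₁`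
(the outer normal cone at every boundary point is a ray — a SMOOTH convex body: Euclidean balls, ellipsoids; never a polytope of
dimension `≥ 1`). -/
def UniqueNormal (Q : Set (ι → ℝ)) : Prop :=
  ∀ z ∈ Q, ∀ c₁ c₂ : ι → ℝ, c₁ ≠ 0 → (∀ w ∈ Q, c₁ ⬝ᵥ w ≤ c₁ ⬝ᵥ z) → (∀ w ∈ Q, c₂ ⬝ᵥ w ≤ c₂ ⬝ᵥ z) →
    ∃ t : ℝ, 0 ≤ t ∧ c₂ = t • c₁

/-- ★ **a smooth passenger is TOTALLY IMMUNE to genus I**: if `Q` has unique normals then NO unique-disjointness pattern of order `m ≥ 2`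
lives on `P + Q`, for ANY set `P` (only the rows `{i}, {j}, {i,j}` and the columns `∅, {i}, {j}, {i,j}` are used: column compliance makes
the three rows positively parallel, and then the tight cell `({i}, {i,j})` and the disjoint cell `({i}, {j})` contradict each other). -/
theorem no_pattern_of_uniqueNormal {m : ℕ} (hm : 2 ≤ m) {P Q : Set (ι → ℝ)} (hQ : UniqueNormal Q)
    (c : Finset (Fin m) → ι → ℝ) (d : Finset (Fin m) → ℝ) (x : Finset (Fin m) → ι → ℝ)
    (hvalid : ∀ a, ∀ w ∈ P + Q, c a ⬝ᵥ w ≤ d a) (hx : ∀ b, x b ∈ P + Q)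
    (htight : ∀ a b, (a ∩ b).card = 1 → c a ⬝ᵥ x b = d a) (hdisj : ∀ a b, Disjoint a b → c a ⬝ᵥ x b < d a) : False := by
  classical
  -- decompose the points and get column compliance by the swap argument
  have hdec : ∀ b, ∃ y z, y ∈ P ∧ z ∈ Q ∧ x b = y + z := by
    intro b
    obtain ⟨y, hy, z, hz, hyz⟩ := Set.mem_add.1 (hx b)
    exact ⟨y, z, hy, hz, hyz.symm⟩
  choose y z hy hz hxyz using hdec
  have hcomp : ∀ a b, (a ∩ b).card = 1 → ∀ w ∈ Q, c a ⬝ᵥ w ≤ c a ⬝ᵥ z b := by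
    intro a b h1
    have ht := htight a b h1
    rw [hxyz b] at ht
    exact swap_max_right (hvalid a) (hy b) ht
  -- every nonempty row is nonzero (tight somewhere, strict at the column `∅`)
  have hne : ∀ a : Finset (Fin m), a.Nonempty → c a ≠ 0 := by
    intro a ha h0
    obtain ⟨i, hi⟩ := ha
    have ht := htight a {i} (by rw [inter_singleton_of_mem hi, card_singleton])
    have hs := hdisj a ∅ (disjoint_empty_right a)
    rw [h0, zero_dotProduct] at ht hs
    linarith
  -- the two indices
  set i : Fin m := ⟨0, by omega⟩ with hi
  set j : Fin m := ⟨1, by omega⟩ with hj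
  have hij : i ≠ j := by simp [hi, hj, Fin.ext_iff]
  -- incidences
  have h_i_i : (({i} : Finset (Fin m)) ∩ {i}).card = 1 := by simp
  have h_j_j : (({j} : Finset (Fin m)) ∩ {j}).card = 1 := by simp
  have h_ij_i : (({i, j} : Finset (Fin m)) ∩ {i}).card = 1 := by simp
  have h_ij_j : (({i, j} : Finset (Fin m)) ∩ {j}).card = 1 := by
    rw [inter_comm]; simp [hij.symm]
  have h_i_ij : (({i} : Finset (Fin m)) ∩ {i, j}).card = 1 := by rw [inter_comm]; exact h_ij_i
  have h_j_ij : (({j} : Finset (Fin m)) ∩ {i, j}).card = 1 := by rw [inter_comm]; exact h_ij_j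
  -- the three rows are positively parallel
  obtain ⟨t, ht0, htij⟩ := hQ (z {i}) (hz {i}) (c {i}) (c {i, j}) (hne {i} (singleton_nonempty i))
    (hcomp {i} {i} h_i_i) (hcomp {i, j} {i} h_ij_i)
  obtain ⟨t', ht0', htij'⟩ := hQ (z {j}) (hz {j}) (c {j}) (c {i, j}) (hne {j} (singleton_nonempty j))
    (hcomp {j} {j} h_j_j) (hcomp {i, j} {j} h_ij_j)
  have htpos : 0 < t := by
    rcases ht0.lt_or_eq with h | h
    · exact h
    · exfalso; apply hne {i, j} ⟨i, by simp⟩; rw [htij, ← h, zero_smul]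
  have ht'pos : 0 < t' := by
    rcases ht0'.lt_or_eq with h | h
    · exact h
    · exfalso; apply hne {i, j} ⟨i, by simp⟩; rw [htij', ← h, zero_smul]
  -- `c {j} = (t / t') • c {i}`
  have hcj : c {j} = (t / t') • c {i} := by
    have : t' • c {j} = t • c {i} := by rw [← htij', htij]
    calc c {j} = (1 / t') • (t' • c {j}) := by rw [smul_smul, one_div_mul_cancel ht'pos.ne', one_smul]
      _ = (t / t') • c {i} := by rw [this, smul_smul]; ring_nf
  -- row `{j}`: tight at columns `{j}` and `{i,j}` ⇒ `c{i} · x{j} = c{i} · x{i,j}`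
  have h1 := htight {j} {j} h_j_j
  have h2 := htight {j} {i, j} h_j_ij
  rw [hcj, smul_dotProduct, smul_eq_mul] at h1 h2
  have heq : c {i} ⬝ᵥ x {j} = c {i} ⬝ᵥ x {i, j} := by
    have := h1.trans h2.symm
    exact mul_left_cancel₀ (div_pos htpos ht'pos).ne' this
  -- row `{i}`: tight at `{i,j}`, strict at the disjoint column `{j}`
  have h3 := htight {i} {i, j} h_i_ij
  have h4 := hdisj {i} {j} (disjoint_singleton.2 hij)
  rw [heq, h3] at h4
  exact lt_irrefl _ h4


/-! ### §4b a kernel instance: the Euclidean unit ball has unique normals, hence is totally immune -/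

/-- the Euclidean unit ball of `ι → ℝ` in dot-product terms. -/
def euclidBall : Set (ι → ℝ) := {z | z ⬝ᵥ z ≤ 1}

-- Port note (val-port-4): the source's one-line helper `dotProduct_self_nonneg' (v) : 0 ≤ v ⬝ᵥ v` restates (dedup lint) a lemma of
-- `Literature/Computability/QuantumComplexity/MatchgateNumerics.lean`, a module with no hub olean; its term
-- `Finset.sum_nonneg fun i _ => mul_self_nonneg (v i)` is therefore inlined at the four call sites below — the only delta of this port.

/-- a maximiser of a nonzero functional over the Euclidean unit ball is the normalised functional (Cauchy–Schwarz through the vector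
`(c·c) z − (c·z) c`). -/
theorem eq_smul_of_max_euclidBall {c z : ι → ℝ} (hc : c ≠ 0) (hz : z ∈ euclidBall) (hmax : ∀ w ∈ euclidBall, c ⬝ᵥ w ≤ c ⬝ᵥ z) :
    c = Real.sqrt (c ⬝ᵥ c) • z := by
  have hcc : 0 < c ⬝ᵥ c := lt_of_le_of_ne (Finset.sum_nonneg fun i _ => mul_self_nonneg (c i)) (fun h => hc (dotProduct_self_eq_zero.1 h.symm))
  set N := Real.sqrt (c ⬝ᵥ c) with hN
  have hNpos : 0 < N := Real.sqrt_pos.2 hcc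
  have hN2 : N * N = c ⬝ᵥ c := Real.mul_self_sqrt hcc.le
  -- the normalised functional is in the ball, so `c · z ≥ N`
  have hw : (1 / N) • c ∈ euclidBall := by
    show ((1 / N) • c) ⬝ᵥ ((1 / N) • c) ≤ 1
    rw [smul_dotProduct, dotProduct_smul, smul_eq_mul, smul_eq_mul, ← hN2]
    field_simp
    exact le_rfl
  have hge : N ≤ c ⬝ᵥ z := by
    have h := hmax _ hw
    rw [dotProduct_smul, smul_eq_mul, ← hN2] at h
    have : 1 / N * (N * N) = N := by field_simp
    linarith
  -- Cauchy–Schwarz via `D := (c·c) • z − (c·z) • c`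
  set D := (c ⬝ᵥ c) • z - (c ⬝ᵥ z) • c with hD
  have hDD : D ⬝ᵥ D = (c ⬝ᵥ c) * ((c ⬝ᵥ c) * (z ⬝ᵥ z) - (c ⬝ᵥ z) * (c ⬝ᵥ z)) := by
    rw [hD, sub_dotProduct, dotProduct_sub, dotProduct_sub, smul_dotProduct, smul_dotProduct, smul_dotProduct, smul_dotProduct,
      dotProduct_smul, dotProduct_smul, dotProduct_smul, dotProduct_smul, dotProduct_comm z c]
    simp only [smul_eq_mul]
    ring
  have hDnn : 0 ≤ D ⬝ᵥ D := Finset.sum_nonneg fun i _ => mul_self_nonneg (D i)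
  have hzz : z ⬝ᵥ z ≤ 1 := hz
  have hzz0 : 0 ≤ z ⬝ᵥ z := Finset.sum_nonneg fun i _ => mul_self_nonneg (z i)
  -- `c · z = N`
  have hle : c ⬝ᵥ z ≤ N := by
    by_contra hlt
    rw [not_le] at hlt
    have h1 : N * N < (c ⬝ᵥ z) * (c ⬝ᵥ z) := mul_lt_mul'' hlt hlt hNpos.le hNpos.le
    have h2 : (c ⬝ᵥ c) * (z ⬝ᵥ z) ≤ c ⬝ᵥ c := by nlinarith
    have h3 : (c ⬝ᵥ c) * ((c ⬝ᵥ c) * (z ⬝ᵥ z) - (c ⬝ᵥ z) * (c ⬝ᵥ z)) < 0 := by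
      apply mul_neg_of_pos_of_neg hcc
      linarith
    linarith
  have heq : c ⬝ᵥ z = N := le_antisymm hle hge
  -- hence `D · D ≤ 0`, `D = 0`, and `c = N • z`
  have hD0 : D = 0 := by
    have : D ⬝ᵥ D ≤ 0 := by
      rw [hDD, heq, hN2]
      have : (c ⬝ᵥ c) * ((c ⬝ᵥ c) * (z ⬝ᵥ z) - c ⬝ᵥ c) = (c ⬝ᵥ c) * (c ⬝ᵥ c) * (z ⬝ᵥ z - 1) := by ring
      rw [this]
      exact mul_nonpos_of_nonneg_of_nonpos (mul_nonneg hcc.le hcc.le) (by linarith)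
    exact dotProduct_self_eq_zero.1 (le_antisymm this hDnn)
  have hcz : (c ⬝ᵥ c) • z = N • c := by
    have := sub_eq_zero.1 (hD ▸ hD0 : (c ⬝ᵥ c) • z - (c ⬝ᵥ z) • c = 0)
    rw [this, heq]
  calc c = (1 / N) • (N • c) := by rw [smul_smul, one_div_mul_cancel hNpos.ne', one_smul]
    _ = (1 / N) • ((c ⬝ᵥ c) • z) := by rw [hcz]
    _ = N • z := by rw [smul_smul, ← hN2]; congr 1; field_simp

/-- ★ the Euclidean unit ball has unique normals … -/
theorem uniqueNormal_euclidBall : UniqueNormal (euclidBall (ι := ι)) := by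
  intro z hz c₁ c₂ hc₁ h₁ h₂
  have e₁ := eq_smul_of_max_euclidBall hc₁ hz h₁
  by_cases hc₂ : c₂ = 0
  · exact ⟨0, le_rfl, by rw [hc₂, zero_smul]⟩
  have e₂ := eq_smul_of_max_euclidBall hc₂ hz h₂
  have hN₁ : 0 < Real.sqrt (c₁ ⬝ᵥ c₁) :=
    Real.sqrt_pos.2 (lt_of_le_of_ne (Finset.sum_nonneg fun i _ => mul_self_nonneg (c₁ i)) (fun h => hc₁ (dotProduct_self_eq_zero.1 h.symm)))
  set N₁ := Real.sqrt (c₁ ⬝ᵥ c₁) with hN₁def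
  set N₂ := Real.sqrt (c₂ ⬝ᵥ c₂) with hN₂def
  refine ⟨N₂ / N₁, div_nonneg (hN₂def ▸ Real.sqrt_nonneg _) hN₁.le, ?_⟩
  rw [e₂, e₁, smul_smul, div_mul_cancel₀ _ hN₁.ne']

/-- … hence `P + (Euclidean unit ball)` carries no unique-disjointness pattern of order `≥ 2`, whatever `P` is (e.g. `P = COR(K_h)`): the
round limit of the polytopal passengers is TOTALLY IMMUNE to genus I. -/
theorem no_pattern_euclidBall {m : ℕ} (hm : 2 ≤ m) (P : Set (ι → ℝ))
    (c : Finset (Fin m) → ι → ℝ) (d : Finset (Fin m) → ℝ) (x : Finset (Fin m) → ι → ℝ)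
    (hvalid : ∀ a, ∀ w ∈ P + euclidBall, c a ⬝ᵥ w ≤ d a) (hx : ∀ b, x b ∈ P + euclidBall)
    (htight : ∀ a b, (a ∩ b).card = 1 → c a ⬝ᵥ x b = d a) (hdisj : ∀ a b, Disjoint a b → c a ⬝ᵥ x b < d a) : False :=
  no_pattern_of_uniqueNormal hm uniqueNormal_euclidBall c d x hvalid hx htight hdisj

end Smooth

end Summit.ValiantsHypothesis.ValiantsHypothesis.Theorems.FifoMatching.PatternSplit
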